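import Literature.Analysis.ValidatedNumerics.TaylorModelExp
import HarnessLib

/-!
# Panel operations on Taylor models: re-centring to sub-panels, sup read-back, exponential factors

Trunk T-ANA (Analysis/ValidatedNumerics); namespace `Literature.Analysis.ValidatedNumerics.PolyMP`.
Sequel of `TaylorModel.lean` / `TaylorModelExp.lean`.  A certificate that bounds `sup |g|` over a
long parameter range covers the range by panels: ONE Taylor model `P` of `g` in the panel variable
`ρ`, `|ρ| ≤ H`, around a panel centre, is RE-CENTRED to the sub-panel centres `c_s` (`shiftI`, an
exact polynomial shift with an enclosed, possibly irrational, offset) and each re-centred model is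
bounded by `tabsI` at the sub-panel half-width `hs`; the only analytic side condition is the
validity-radius budget `hs + |c_s| ≤ H`.  This file proves the soundness of exactly these steps:

* `tmem_shiftI` — re-centring: `TMem S H f P`, `c ∈ C`, `hs + |c| ≤ H` ⟹
  `TMem S hs (ρ ↦ f (c + ρ)) (shiftI S P C)`;
* `abs_recentre_le_tabsI`, `abs_recentre_le_getD_map_tabsI` — the sup read-back on one sub-panel
  and on a list of sub-panels `(List.range n).map (fun s ↦ tabsI S hs (shiftI S P (C s)))`;
* `tmem_exp_mul_add`, `tmem_exp_mul_add_of_exp_eq_some` — the Taylor model of an exponential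
  factor `ρ ↦ e^{q(c+ρ)} = e^{qc}·e^{qρ}` at an ENCLOSED centre `c` (constant part by the interval
  exponential `MI.exp`, variable part by `texpI`), the building block of models in a logarithmic
  panel variable (`ρ ↦ e^{±(c+ρ)}`, `e^{±3(c+ρ)/2}`, …).

Theorems only; no facts, no axioms beyond the standard three.

## References

* K. Makino, M. Berz, *Taylor models and other validated functional inclusion methods*,
  Int. J. Pure Appl. Math. 4 (2003), 379–456 — Def 1 (Taylor model on a domain around `x₀`),
  Def 2–3 and Thm 2 (FTTMA; Def 3 «Exponential» eq. (2.2): `exp(c_f + f̄) = exp(c_f)·exp(f̄)`),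
  §3 (range bounding of Taylor models over sub-domains); held as `paper:galaxy-pdf-578413100`
  (chunk locators `pNNNN:Ln`). [cite: MakinoBerz2003, Def 1–3, Thm 2, §3]
-/

namespace Literature.Analysis.ValidatedNumerics

namespace PolyMP

open Literature.Analysis.ValidatedNumerics.NumericsMP
open Finset

variable {S : ℕ}

/-! ### Re-centring -/

/-- **Re-centring a Taylor model.**  If `P` encloses `f` on `|ρ| ≤ H` and `c ∈ C` with
`hs + |c| ≤ H`, then the shifted interval polynomial `shiftI S P C` encloses `ρ ↦ f (c + ρ)` on the
sub-panel `|ρ| ≤ hs` (the new expansion point is `c`; the validity radius shrinks by `|c|`).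
[cite: MakinoBerz2003, Def 1 eq. (2.1) (Taylor model around a point `x₀` on a domain `D`; re-expansion about a point of `D`), chunk p0005:L1; Thm 2 (FTTMA), chunk p0009:L7] -/
theorem tmem_shiftI (hS : 0 < S) {H hs : ℚ} {f : ℝ → ℝ} {P : IPoly} (hf : TMem S H f P)
    {c : ℝ} {C : MI} (hc : MI.mem S c C) (hrad : (hs : ℝ) + |c| ≤ H) :
    TMem S hs (fun ρ => f (c + ρ)) (shiftI S P C) := fun ρ hρ => by
  have hcρ : |c + ρ| ≤ (H : ℝ) := (abs_add_le c ρ).trans (by linarith)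
  obtain ⟨as, has, e⟩ := hf (c + ρ) hcρ
  refine ⟨shiftR as c, pmem_shiftI hS hc has, ?_⟩
  show f (c + ρ) = evalR (shiftR as c) ρ
  rw [e, evalR_shiftR]

/-- **Sup read-back on one sub-panel.**  Under the hypotheses of `tmem_shiftI` (and `0 ≤ hs`),
`|f (c + ρ)| · S ≤ tabsI S hs (shiftI S P C)` for every `|ρ| ≤ hs`.
[cite: MakinoBerz2003, §3 (bounding the range of a Taylor model over a sub-domain: polynomial bound `B(P)` plus remainder), chunks p0005:L17, p0020:L5; Thm 2] -/
theorem abs_recentre_le_tabsI (hS : 0 < S) {H hs : ℚ} (h0 : 0 ≤ hs) {f : ℝ → ℝ} {P : IPoly}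
    (hf : TMem S H f P) {c : ℝ} {C : MI} (hc : MI.mem S c C) (hrad : (hs : ℝ) + |c| ≤ H)
    {ρ : ℝ} (hρ : |ρ| ≤ hs) :
    |f (c + ρ)| * S ≤ (tabsI S hs (shiftI S P C) : ℝ) :=
  abs_le_tabsI h0 (tmem_shiftI hS hf hc hrad) hρ

/-- `((List.range n).map F).getD s d = F s` for `s < n`. [folklore] -/
private theorem getD_map_range' {α : Type*} (n : ℕ) (F : ℕ → α) (d : α) {s : ℕ} (hs : s < n) :
    ((List.range n).map F).getD s d = F s := by
  rw [List.getD_eq_getElem?_getD, List.getElem?_map, List.getElem?_range hs]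
  simp

/-- **Sup read-back on a list of sub-panels.**  With sub-panel centres `c s ∈ C s` (`s < n`), all
within the radius budget `hs + |c s| ≤ H`, the table
`M = (List.range n).map (fun s ↦ tabsI S hs (shiftI S P (C s)))` satisfies
`|f (c s + ρ)| · S ≤ M.getD s d` for every `s < n` and `|ρ| ≤ hs`.
[cite: MakinoBerz2003, §3 (range bounding over sub-domains), chunk p0020:L5; Thm 2 (FTTMA), chunk p0009:L7] -/
theorem abs_recentre_le_getD_map_tabsI (hS : 0 < S) {H hs : ℚ} (h0 : 0 ≤ hs) {f : ℝ → ℝ}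
    {P : IPoly} (hf : TMem S H f P) {n : ℕ} {c : ℕ → ℝ} {C : ℕ → MI}
    (hc : ∀ s, s < n → MI.mem S (c s) (C s)) (hrad : ∀ s, s < n → (hs : ℝ) + |c s| ≤ H)
    (d : ℤ) {s : ℕ} (hsn : s < n) {ρ : ℝ} (hρ : |ρ| ≤ hs) :
    |f (c s + ρ)| * S ≤ (((List.range n).map fun s => tabsI S hs (shiftI S P (C s))).getD s d : ℝ) := by
  rw [getD_map_range' n _ d hsn]
  exact abs_recentre_le_tabsI hS h0 hf (hc s hsn) (hrad s hsn) hρ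

/-- **Two-sided read-back on one sub-panel** (upper and lower range bounds after re-centring).
[cite: MakinoBerz2003, §3 (range bounding over sub-domains), chunk p0020:L5; Thm 2] -/
theorem recentre_bounds (hS : 0 < S) {H hs : ℚ} (h0 : 0 ≤ hs) {f : ℝ → ℝ} {P : IPoly}
    (hf : TMem S H f P) {c : ℝ} {C : MI} (hc : MI.mem S c C) (hrad : (hs : ℝ) + |c| ≤ H)
    {ρ : ℝ} (hρ : |ρ| ≤ hs) :
    (tlowerI S hs (shiftI S P C) : ℝ) ≤ f (c + ρ) * S ∧
      f (c + ρ) * S ≤ (tupperI S hs (shiftI S P C) : ℝ) :=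
  ⟨tlowerI_le h0 (tmem_shiftI hS hf hc hrad) hρ, le_tupperI h0 (tmem_shiftI hS hf hc hrad) hρ⟩

/-! ### Exponential factors at an enclosed centre -/

/-- **`ρ ↦ e^{q(c+ρ)}` as a Taylor model**: if `E` encloses the constant `e^{qc}`, then
`tsmulI S E (texpI S h K q)` encloses `ρ ↦ e^{q(c+ρ)} = e^{qc} · e^{qρ}` on `|ρ| ≤ h`
(`0 < K`, `|q h| ≤ 1`).
[cite: MakinoBerz2003, Def 3 «Exponential» eq. (2.2) (`exp(c_f + f̄) = exp(c_f)·exp(f̄)`), chunk p0005:L25–L37; Thm 2 (FTTMA), chunk p0009:L7] -/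
theorem tmem_exp_mul_add (hS : 0 < S) {h : ℚ} {K : ℕ} (hK : 0 < K) {q : ℚ} (hqh : |q * h| ≤ 1)
    {c : ℝ} {E : MI} (hE : MI.mem S (Real.exp (q * c)) E) :
    TMem S h (fun ρ => Real.exp (q * (c + ρ))) (tsmulI S E (texpI S h K q)) := by
  have key := tmem_smulI hS hE (tmem_exp (S := S) hK hqh)
  intro ρ hρ
  obtain ⟨as, has, e⟩ := key ρ hρ
  refine ⟨as, has, ?_⟩
  show Real.exp (q * (c + ρ)) = evalR as ρ
  rw [← e]
  show Real.exp (q * (c + ρ)) = Real.exp (q * c) * Real.exp (q * ρ)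
  rw [mul_add, Real.exp_add]

/-- `tmem_exp_mul_add` with the constant produced by the interval exponential: if `X` encloses
`q·c` and `MI.exp S Ke ke X = some E`, then `tsmulI S E (texpI S h K q)` encloses
`ρ ↦ e^{q(c+ρ)}`.  (This is the shape `texpAt` of panel certificates in a logarithmic variable.)
[cite: MakinoBerz2003, Def 3 «Exponential» eq. (2.2), chunk p0005:L25–L37; Thm 2 (FTTMA), chunk p0009:L7] -/
theorem tmem_exp_mul_add_of_exp_eq_some (hS : 0 < S) {h : ℚ} {K : ℕ} (hK : 0 < K) {q : ℚ}
    (hqh : |q * h| ≤ 1) {c : ℝ} {X E : MI} {Ke ke : ℕ} (hX : MI.mem S ((q : ℝ) * c) X)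
    (hE : MI.exp S Ke ke X = some E) :
    TMem S h (fun ρ => Real.exp (q * (c + ρ))) (tsmulI S E (texpI S h K q)) :=
  tmem_exp_mul_add hS hK hqh (MI.mem_exp hS hE hX)

/-- The enclosure of `q·c` from an enclosure of `c` and the thin rational `q`, in the argument
order `C · q` used by panel certificates. [cite: MakinoBerz2003, Def 2 (multiplication; a constant is a degree-0 Taylor model), chunk p0005:L11] -/
theorem mem_mul_ofRat (hS : 0 < S) {c : ℝ} {C : MI} (hc : MI.mem S c C) (q : ℚ) :
    MI.mem S ((q : ℝ) * c) (MI.mul S C (ofRat S q)) := by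
  have := MI.mem_mul hS hc (mem_ofRat S q)
  rwa [mul_comm] at this

end PolyMP

end Literature.Analysis.ValidatedNumerics
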